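import Literature.NumberTheory.Irrationality.Fischler2002.Theoreme32PermProofs
import Literature.NumberTheory.Irrationality.Fischler2002.JnPhiProofs
import Literature.NumberTheory.Irrationality.Fischler2002.JnPsiProofs
import HarnessLib

/-!
# Fischler 2002, Théorème 3.2 — brick V: invariance of `𝒥(p)/(normalising factorials)` under `σ, ψ, φ` and along criterion words

Topic `Literature/NumberTheory/Irrationality/Fischler2002`. PROOFS ONLY (no definition, no statement, no discharge): fifth brick toward
the named fact `theoreme32` of `RhinViolaGroupsGeneral.lean`, whose last clause reads « il laisse stable
`𝒥(p)/(a_{n−1}! b_{n−1}! a₂! b₃!)` si `n ≥ 5`, et `𝒥(p)/(a₃! b₃! a₂!)` si `n = 4` … `𝒥(p)/(a₁! a₂! a₃! b₁! b₂! b₃! (a₂+b₃−c₃)! (b₁+b₃−c₃)!)`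
(`n = 3`) … `𝒥(p)/(a₁! a₂! b₁! b₂! (a₁+b₂−c₂)!)` (`n = 2`) » [Fischler2002Polyzetas, §3 Théorème 3.2; `paper:arxiv-math_0202064` p. 4]
(typed: `rvNormaliser`). This file proves the invariance ONE GENERATOR AT A TIME, for every `n ≥ 2` and `p ∈ 𝓔`:
* `normaliser_sigma`, `normaliser_psi` — `σ` and `ψ` PERMUTE the normalising factorials on `𝓔` (using `a₂ = b₁` for `n ≥ 4`), and
  `𝒥` itself is invariant (`Jn_sigma_holds`, ct-1 g30's `Jn_psi_holds`): `step_sigma`, `step_psi`;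
* `normaliser_phi` — under `φ` the normaliser changes by EXACTLY Euler's factor:
  `N(p)·c_n!·(a_{n−1}+b_{n−1}−c_n)! = N(φp)·a_{n−1}!·b_{n−1}!` in all four cases `n = 2, 3, 4, ≥ 5`; with ct-1 g29's `Jn_phi_holds`
  this gives `step_phi : 𝒥(φp)/N(φp) = 𝒥(p)/N(p)` whenever `p` and `φp` both satisfy the finiteness criterion.
* `transport`, `exists_rat_of_transport` — along any WORD in `σ', ψ', φ'` all of whose intermediate points satisfy the criterion,
  `𝒥(w·p)/N(w·p) = 𝒥(p)/N(p)`, hence `𝒥(w·p) = (N(w·p)/N(p))·𝒥(p)` with a positive rational factor (the shape of `IsRhinViolaGroup`).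
What remains for the two last clauses of `theoreme32` is COMBINATORIAL: joining `p` to `gp` through criterion points (the seat's recon
memo §5: possible in every case searched for `n = 2` and `n ≥ 4`, NOT always for `n = 3`, where the identity nevertheless holds in the
examples computed by hand). Cell `pub-zeta5`, seat ct-1 g33, 2026-08-27/28.

HONEST FRAMING (cell pub-zeta5): systematic search; no irrationality claim unless certified — identities between (possibly infinite)
integrals of non-negative functions and factorial bookkeeping; nothing about `ζ(5)`.
-/

noncomputable section

namespace Literature.NumberTheory.Irrationality.Fischler2002

namespace Theoreme32

open scoped ENNReal

/-! ### The normaliser is a positive integer -/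

/-- `rvNormaliser n p ≥ 1` (a product of factorials). [cite: Fischler2002Polyzetas, §3 Théorème 3.2] -/
theorem rvNormaliser_pos (n : ℕ) (p : Exponents) : 0 < rvNormaliser n p := by
  unfold rvNormaliser
  split_ifs <;> positivity

/-! ### `σ` and `ψ` permute the normalising factorials -/

/-- `N(σp) = N(p)` on `𝓔` (`n ≥ 2`). [cite: Fischler2002Polyzetas, §3 Théorème 3.2] -/
theorem normaliser_sigma {n : ℕ} (hn : 2 ≤ n) {p : Exponents} (hp : InE n p) :
    rvNormaliser n (sigma p) = rvNormaliser n p := by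
  obtain ⟨-, -, h4⟩ := hp
  unfold rvNormaliser
  rcases Nat.lt_or_ge n 5 with hlt | hge
  · interval_cases n
    · rw [show (sigma p).a 1 + (sigma p).b 2 - (sigma p).c 2 = p.a 1 + p.b 2 - p.c 2 by simp [sigma]; ring]
      simp [sigma]; left; ring
    · rw [show (sigma p).a 2 + (sigma p).b 3 - (sigma p).c 3 = p.b 1 + p.b 3 - p.c 3 by simp [sigma],
        show (sigma p).b 1 + (sigma p).b 3 - (sigma p).c 3 = p.a 2 + p.b 3 - p.c 3 by simp [sigma]]
      simp [sigma]; ring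
    · obtain ⟨h21, -, -⟩ := h4 (by norm_num)
      simp [sigma, h21]
  · obtain ⟨h21, -, -⟩ := h4 (by omega)
    simp [sigma, show n ≠ 2 by omega, show n ≠ 3 by omega, show n ≠ 4 by omega, show n - 1 ≠ 1 by omega,
      show n - 1 ≠ 2 by omega, h21]

/-- `N(ψp) = N(p)` on `𝓔` (`n ≥ 2`). [cite: Fischler2002Polyzetas, §3 Théorème 3.2] -/
theorem normaliser_psi {n : ℕ} (hn : 2 ≤ n) {p : Exponents} (hp : InE n p) :
    rvNormaliser n (psi n p) = rvNormaliser n p := by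
  unfold rvNormaliser
  rcases Nat.lt_or_ge n 5 with hlt | hge
  · interval_cases n
    · rw [show (psi 2 p).a 1 + (psi 2 p).b 2 - (psi 2 p).c 2 = p.b 1 by simp [psi]]
      simp [psi]; ring
    · rw [show (psi 3 p).a 2 + (psi 3 p).b 3 - (psi 3 p).c 3 = p.b 1 by simp [psi],
        show (psi 3 p).b 1 + (psi 3 p).b 3 - (psi 3 p).c 3 = p.b 1 + p.b 3 - p.c 3 by simp [psi]; ring]
      simp [psi]; left; ring
    · simp [psi]; ring
  · have e1 : n + 1 - (n - 1) = 2 := by omega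
    have e2 : n + 2 - (n - 1) = 3 := by omega
    have e3 : n + 1 - 2 = n - 1 := by omega
    have e4 : n + 2 - 3 = n - 1 := by omega
    simp [psi, show n ≠ 2 by omega, show n ≠ 3 by omega, show n ≠ 4 by omega, show 1 ≤ n - 1 ∧ n - 1 ≤ n from ⟨by omega, by omega⟩,
      show n - 1 ≠ 1 by omega, show 2 ≤ n - 1 ∧ n - 1 ≤ n from ⟨by omega, by omega⟩, show (2 : ℕ) ≤ n by omega,
      show (3 : ℕ) ≤ n by omega, e1, e2, e3, e4]
    ring

/-! ### `φ` changes the normaliser by Euler's factor -/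

/-- **`N(p)·c_n!·(a_{n−1}+b_{n−1}−c_n)! = N(φp)·a_{n−1}!·b_{n−1}!`** on `𝓔`, for every `n ≥ 2` (the four printed normalisers).
[cite: Fischler2002Polyzetas, §3 Théorème 3.2 (with the formula for φ, p. 4)] -/
theorem normaliser_phi {n : ℕ} (hn : 2 ≤ n) {p : Exponents} (hp : InE n p) :
    rvNormaliser n p * ((p.c n).toNat.factorial * (p.a (n - 1) + p.b (n - 1) - p.c n).toNat.factorial) =
      rvNormaliser n (phi n p) * ((p.a (n - 1)).toNat.factorial * (p.b (n - 1)).toNat.factorial) := by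
  unfold rvNormaliser
  rcases Nat.lt_or_ge n 5 with hlt | hge
  · interval_cases n
    · rw [show (phi 2 p).a 1 + (phi 2 p).b 2 - (phi 2 p).c 2 = p.b 2 by simp [phi]]
      simp [phi]; ring
    · rw [show (phi 3 p).a 2 + (phi 3 p).b 3 - (phi 3 p).c 3 = p.b 3 by simp [phi],
        show (phi 3 p).b 1 + (phi 3 p).b 3 - (phi 3 p).c 3 = p.b 1 + p.b 3 - p.c 3 by simp [phi]; ring]
      simp [phi]; ring
    · simp [phi]; ring
  · simp [phi, show n ≠ 2 by omega, show n ≠ 3 by omega, show n ≠ 4 by omega, show (2 : ℕ) ≠ n - 1 by omega,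
      show (3 : ℕ) ≠ n - 1 by omega, show (3 : ℕ) ≠ n by omega]
    ring

/-! ### The one-step invariance of `𝒥/N` -/

/-- **`σ`-step**: `𝒥(σp)/N(σp) = 𝒥(p)/N(p)` on `𝓔` (`n ≥ 2`). [cite: Fischler2002Polyzetas, §3 Théorème 3.2] -/
theorem step_sigma {n : ℕ} (hn : 2 ≤ n) {p : Exponents} (hp : InE n p) :
    Jn n (sigma p) / (rvNormaliser n (sigma p) : ℝ≥0∞) = Jn n p / (rvNormaliser n p : ℝ≥0∞) := by
  rw [Jn_sigma_holds n p hn, normaliser_sigma hn hp]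

/-- **`ψ`-step**: `𝒥(ψp)/N(ψp) = 𝒥(p)/N(p)` on `𝓔` (`n ≥ 2`). [cite: Fischler2002Polyzetas, §3 Théorème 3.2] -/
theorem step_psi {n : ℕ} (hn : 2 ≤ n) {p : Exponents} (hp : InE n p) :
    Jn n (psi n p) / (rvNormaliser n (psi n p) : ℝ≥0∞) = Jn n p / (rvNormaliser n p : ℝ≥0∞) := by
  rw [Jn_psi_holds n p hn, normaliser_psi hn hp]

/-- **`φ`-step**: if `p ∈ 𝓔` and both `p` and `φp` satisfy the finiteness criterion then `𝒥(φp)/N(φp) = 𝒥(p)/N(p)` — Euler's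
exchange in `x_{n−1}` (`Jn_phi_holds`; its sign hypotheses `c_n ≥ 0`, `a_{n−1}+b_{n−1}−c_n ≥ 0` are `a'_{n−1}, b'_{n−1} ≥ 0` of the
criterion for `φp`) against `normaliser_phi`. [cite: Fischler2002Polyzetas, §3 Théorème 3.2 (with the formula for φ, p. 4)] -/
theorem step_phi {n : ℕ} (hn : 2 ≤ n) {p : Exponents} (hp : InE n p) (hc : FinitenessCriterionGen n p)
    (hc' : FinitenessCriterionGen n (phi n p)) :
    Jn n (phi n p) / (rvNormaliser n (phi n p) : ℝ≥0∞) = Jn n p / (rvNormaliser n p : ℝ≥0∞) := by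
  have hmem : n - 1 ∈ Finset.Icc 1 n := Finset.mem_Icc.2 ⟨by omega, by omega⟩
  have hcn : 0 ≤ p.c n := by simpa [phi] using hc'.1 (n - 1) hmem
  have hs : 0 ≤ p.a (n - 1) + p.b (n - 1) - p.c n := by simpa [phi] using hc'.2.1 (n - 1) hmem
  have hE := Jn_phi_holds n p hn hp.1 hc hcn hs
  set F₁ : ℕ := (p.a (n - 1)).toNat.factorial * (p.b (n - 1)).toNat.factorial with hF₁
  set F₂ : ℕ := (p.c n).toNat.factorial * (p.a (n - 1) + p.b (n - 1) - p.c n).toNat.factorial with hF₂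
  have hF₁pos : (0 : ℝ) < F₁ := by rw [hF₁]; positivity
  have hF₂pos : (0 : ℝ) < F₂ := by rw [hF₂]; positivity
  have hN := normaliser_phi hn hp
  rw [← hF₁, ← hF₂] at hN
  have hNpos := rvNormaliser_pos n p
  have hN'pos := rvNormaliser_pos n (phi n p)
  rw [ENNReal.div_eq_div_iff (by exact_mod_cast hNpos.ne') (ENNReal.natCast_ne_top _)
    (by exact_mod_cast hN'pos.ne') (ENNReal.natCast_ne_top _), hE, ← mul_assoc]
  congr 1
  -- `N(p) = N(φp) · F₁/F₂` in `ℝ≥0∞`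
  have hreal : (rvNormaliser n p : ℝ) = (rvNormaliser n (phi n p) : ℝ) * ((F₁ : ℝ) / F₂) := by
    rw [eq_comm, mul_div_assoc', div_eq_iff hF₂pos.ne']
    exact_mod_cast hN.symm
  rw [← ENNReal.ofReal_natCast (rvNormaliser n p), hreal, ENNReal.ofReal_mul (by positivity), ENNReal.ofReal_natCast]

/-! ### Transport along words inside the criterion -/

section Transport

variable {n : ℕ} {gσ gψ gφ : Equiv.Perm {p : Exponents // InE n p}}

/-- **One generator step inside the criterion preserves `𝒥/N`.** [cite: Fischler2002Polyzetas, §3 Théorème 3.2] -/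
theorem step_gen (hn : 2 ≤ n) (hσ : ∀ p, (gσ p).1 = sigma p.1) (hψ : ∀ p, (gψ p).1 = psi n p.1)
    (hφ : ∀ p, (gφ p).1 = phi n p.1) {g : Equiv.Perm {p : Exponents // InE n p}} (hg : g = gσ ∨ g = gψ ∨ g = gφ)
    (q : {p : Exponents // InE n p}) (hq : FinitenessCriterionGen n q.1) (hgq : FinitenessCriterionGen n (g q).1) :
    Jn n (g q).1 / (rvNormaliser n (g q).1 : ℝ≥0∞) = Jn n q.1 / (rvNormaliser n q.1 : ℝ≥0∞) := by
  rcases hg with rfl | rfl | rfl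
  · rw [hσ q]; exact step_sigma hn q.2
  · rw [hψ q]; exact step_psi hn q.2
  · rw [hφ q] at hgq ⊢; exact step_phi hn q.2 hq hgq

/-- **Transport along a word inside the criterion.** If `w` is a word in `σ', ψ', φ'` and every point `(w.drop k).prod p`
(`k ≤ |w|`, i.e. `p` itself and all partial images) satisfies the finiteness criterion, then `𝒥(w·p)/N(w·p) = 𝒥(p)/N(p)`.
[cite: Fischler2002Polyzetas, §3 Théorème 3.2] [cite: Fischler2003RhinViola, §3.3 Théorème 5] -/
theorem transport (hn : 2 ≤ n) (hσ : ∀ p, (gσ p).1 = sigma p.1) (hψ : ∀ p, (gψ p).1 = psi n p.1)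
    (hφ : ∀ p, (gφ p).1 = phi n p.1) (w : List (Equiv.Perm {p : Exponents // InE n p}))
    (hw : ∀ g ∈ w, g = gσ ∨ g = gψ ∨ g = gφ) (p : {p : Exponents // InE n p})
    (hpath : ∀ k, k ≤ w.length → FinitenessCriterionGen n ((w.drop k).prod p).1) :
    Jn n (w.prod p).1 / (rvNormaliser n (w.prod p).1 : ℝ≥0∞) = Jn n p.1 / (rvNormaliser n p.1 : ℝ≥0∞) := by
  induction w with
  | nil => simp
  | cons g w ih =>
    have hw' : ∀ g' ∈ w, g' = gσ ∨ g' = gψ ∨ g' = gφ := fun g' hg' => hw g' (List.mem_cons_of_mem _ hg')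
    have hpath' : ∀ k, k ≤ w.length → FinitenessCriterionGen n ((w.drop k).prod p).1 := fun k hk => by
      have h := hpath (k + 1) (by simpa using hk)
      simpa using h
    have hq : FinitenessCriterionGen n (w.prod p).1 := by simpa using hpath' 0 (Nat.zero_le _)
    have hgq : FinitenessCriterionGen n (g (w.prod p)).1 := by simpa using hpath 0 (Nat.zero_le _)
    rw [List.prod_cons, Equiv.Perm.mul_apply, step_gen hn hσ hψ hφ (hw g (by simp)) (w.prod p) hq hgq]
    exact ih hw' hpath'

/-- **Consequence: a rational ratio.** Under the hypotheses of `transport`, `𝒥(w·p) = (N(w·p)/N(p)) · 𝒥(p)`, the factor being a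
(positive) rational number — the shape asked by `IsRhinViolaGroup`. [cite: Fischler2002Polyzetas, §3 Théorème 3.2 and Définition 1.1] -/
theorem exists_rat_of_transport (hn : 2 ≤ n) (hσ : ∀ p, (gσ p).1 = sigma p.1) (hψ : ∀ p, (gψ p).1 = psi n p.1)
    (hφ : ∀ p, (gφ p).1 = phi n p.1) (w : List (Equiv.Perm {p : Exponents // InE n p}))
    (hw : ∀ g ∈ w, g = gσ ∨ g = gψ ∨ g = gφ) (p : {p : Exponents // InE n p})
    (hpath : ∀ k, k ≤ w.length → FinitenessCriterionGen n ((w.drop k).prod p).1) :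
    ∃ q : ℚ, 0 < q ∧ Jn n (w.prod p).1 = ENNReal.ofReal q * Jn n p.1 := by
  have ht := transport hn hσ hψ hφ w hw p hpath
  have hN := rvNormaliser_pos n p.1
  have hN' := rvNormaliser_pos n (w.prod p).1
  refine ⟨(rvNormaliser n (w.prod p).1 : ℚ) / rvNormaliser n p.1, by positivity, ?_⟩
  have hcast : (((rvNormaliser n (w.prod p).1 : ℚ) / rvNormaliser n p.1 : ℚ) : ℝ) =
      (rvNormaliser n (w.prod p).1 : ℝ) / (rvNormaliser n p.1 : ℝ) := by push_cast; rfl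
  rw [hcast, ENNReal.ofReal_div_of_pos (by exact_mod_cast hN), ENNReal.ofReal_natCast, ENNReal.ofReal_natCast]
  rw [ENNReal.div_eq_div_iff (by exact_mod_cast hN.ne') (ENNReal.natCast_ne_top _) (by exact_mod_cast hN'.ne')
    (ENNReal.natCast_ne_top _)] at ht
  -- `ht : N(p) * 𝒥(w·p) = N(w·p) * 𝒥(p)`
  calc Jn n (w.prod p).1 = (rvNormaliser n (w.prod p).1 : ℝ≥0∞) * Jn n p.1 / (rvNormaliser n p.1 : ℝ≥0∞) :=
        (ENNReal.eq_div_iff (by exact_mod_cast hN.ne') (ENNReal.natCast_ne_top _)).2 ht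
    _ = (rvNormaliser n (w.prod p).1 : ℝ≥0∞) / (rvNormaliser n p.1 : ℝ≥0∞) * Jn n p.1 := by
        rw [mul_comm (rvNormaliser n (w.prod p).1 : ℝ≥0∞), mul_div_assoc, mul_comm]

end Transport

end Theoreme32

end Literature.NumberTheory.Irrationality.Fischler2002

end
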